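/-
Copyright: statement-level skeleton of a published paper (lit-balaban cell, Phase-2 proof seat p39 gen 13). No proof claims
beyond what the kernel checks below.
-/
import Literature.MathematicalPhysics.QuantumFieldTheory.Balaban1983to89.B3WT226Derivative

/-!
# B3 — T. Bałaban, *(Higgs)₂,₃ quantum fields in a finite volume. III. Renormalization*, CMP **88** (1983) 411–445
[Balaban1983Higgs3], (2.28) p. 431 [PDF 21], LEFT MEMBER: **the Ward–Takahashi identity obtained by the operations of (2.26) "in the
presence of" a gauge-invariant function `F(φ)`** — the `A`-derivative at `A = 0` of (2.24) with `F` inserted — ON THE CONCRETE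
LATTICE MODEL, for every admissible gauge-invariant `F` and in particular for the three functions named on p. 430,
`F(φ) = −λ_kΣ_xη^d:|φ(x)|⁴:`, `F(φ) = −½Σ_xη^dδm²_l(x):|φ(x)|²:`, `F(φ) = −λ_kC^η_{M²}(0)Σ_xη^d:|φ(x)|²:`

statement-level skeleton of published theorems with citation tags; proofs where landed; nothing here is a claim about
the Yang–Mills mass gap

PDF held: `paper:balaban1983-higgs-2-3-quantum-fields-finite-volume` (journal page = PDF page + 410); pp. 430–431 [PDF 20–21] read on
the ×4 renders `run/shared/lean/pub/pub-balaban/b2b-balaban-ref1/pages/1983-cmp88-higgs23-III/1983-cmp88-higgs23-III-p020-x4.png`,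
`…-p021-x4.png`.

CITATION HEADER (lean-in-tree rule).  Part of the lit-balaban TYPED SKELETON (HOME `run/shared/lean/pub/lit-balaban/`), PHASE 2,
proof seat p39 (generation 13).  Row **B3.Eq2.26-2.28** of `HOME/lit-balaban-r15/ROWS-B3.md` (fold owner r15; head `typed p247909`,
open: the pictures (2.27)/(2.28) and the prose *"Taking other functions F"*).  Sequel of this seat's gen-2/3 files `B3WT223Instance`
((2.23), `eq223`), `B3WT224Instance` ((2.24) for EVERY admissible gauge-invariant `F`, `eq224`), `B3WT226Pairings` (the pairings
`curJ = ⟨∂^ηφ, Bqφ⟩`, `locQ = ⟨φ, B·∂^ηλq²φ⟩`, `derQ = ⟨∂^ηφ, B∂^ηλq²φ⟩`, the derivatives `hasDerivAt_weight_lin`,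
`hasDerivAt_pairDA_lin`, the bounds `abs_pairJ_le`, `abs_pairDAdot_le`) and `B3WT226Derivative` ((2.26) left member for `F = 1`,
`eq226_deriv`, the normal ordering `normOrd`, `normOrd_pairD`); all reused BY NAME, nothing re-declared.

THE PRINTED TEXT (verbatim, pp. 430–431).  *"Now differentiating (2.24) with respect to A, connecting the vertices by properly
localized propagators, and calculating the Gaussian integrals [F(φ) is chosen as a polynomial, e.g. we can take
F(φ) = −λ_k:|φ(x)|⁴:, or F(φ) = −½δm²_l(x):|φ(x)|²:, or F(φ) = −λ_kC^η_{M²}(0):|φ(x)|²:], we get a set of Ward-Takahashi identities.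
… Taking F = 1, differentiating with respect to A and next taking A = 0 and using the identity (2.25), we get [(2.26)] … Doing next
the same operations as above but in the presence of F(φ) = −λ_k Σ_{x∈Δ} η^d:|φ(x)|⁴:, we get the identities represented graphically in
the following way: [(2.28)]. Taking other functions F, or differentiating (2.24) to higher order in A, we can get all necessary
Ward-Takahashi identities."*

WHAT IS PROVED (theorems only; the lattice model of `B3WT223Instance`/`B3WT224Instance`: fields `φ : T^{(j)} → R^N`, Lebesgue `dφ`,
`U(A) = exp(qηeA)`, weight `w = η^d > 0`, lattice factor `c`, mass `M² > 0`, charged coupling `cηe ≠ 0`).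
* `eq226F_deriv` — **"the same operations as above but in the presence of F(φ)"**: for EVERY direction `B` of the vector field,
  gauge function `λ`, and every continuous gauge-invariant `F` of exponential-linear growth,
  `∫dφ e^{−½⟨φ,(−Δ^η+M²)φ⟩} F(φ)[(−cηe⟨∂^ηφ,Bqφ⟩)⟨∂^ηφ,∂^ηλqφ⟩ − cηe⟨φ,B·∂^ηλq²φ⟩ − ηe⟨∂^ηφ,B∂^ηλq²φ⟩] = 0`
  — the printed route: `s ↦ ∫dφ e^{−½⟨φ,(−Δ_{sB}+M²)φ⟩}F(φ)⟨D_{sB}φ,∂λqU(sB)φ⟩` vanishes identically by (2.24) WITH `F`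
  (`B3WT224Instance.eq224`), is differentiable at `s = 0` under the integral sign (dominated convergence: the Gaussian majorant
  `B3WT224Instance.integrable_explin_mul_gauss` absorbs the growth `Ke^{κ‖φ‖}` of `F`), and a vanishing family has derivative `0`
  (`B3Sect2StatementsPart2.deriv_eq_zero_of_invariant` BY NAME); `eq226F_left` — the same with the normal ordering
  `:⟨∂^ηφ,∂^ηλqφ⟩:` inserted (harmless: its `dμ_C`-mean vanishes by (2.25), `normOrd_pairD`) and normalized by `Z = ∫dφ e^{−½⟨φ,(−Δ^η+M²)φ⟩}`;
  `F = 1` recovers gen-3's `eq226_left` (`eq226F_left_one`).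
* the admissible functions of p. 430: `localEvenPoly_rot` (gauge invariance of `Σ_xη^d(α(x)|φ(x)|⁴ + β(x)|φ(x)|² + γ(x))` — the
  Wick-ordered `:|φ|⁴:`, `:|φ|²:` are of this form for suitable constants, whatever the ordering covariance), `continuous_localEvenPoly`,
  `abs_localEvenPoly_le` (growth `≤ Ke^{4‖φ‖}`), and **`eq228_left`**: the (2.28)-identity — (2.26)'s left member in the presence of
  `F(φ) = Σ_{x}η^d(α(x)|φ(x)|⁴ + β(x)|φ(x)|² + γ(x))` — VANISHES, for all coefficient functions `α, β, γ` (so for `−λ_kΣ_{x∈Δ}η^d:|φ(x)|⁴:`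
  take `α = −λ_k𝟙_Δ` and the Wick constants in `β, γ`; for `−½δm²_l(x):|φ(x)|²:` take `α = 0`, `β = −½δm²_l`).
HONEST SCOPE: the LEFT members (the Gaussian-integral identities) on the model torus; the RIGHT members of (2.28) — the pictures,
i.e. the Wick evaluation of these Gaussian integrals into products of propagators `C^η_{M²}` — are not drawn here (the general
contraction rule is this seat's `Literature/Probability/Distributions/GaussianWickTheorem` / `B3GaussianContractions`); "higher order
in A" is not done.  Mathlib + the cited tree files only; theorems, no definition, no named fact, no `sorry`; standard axioms.  Unit
`lit-balaban-p39-g13` (Phase-2 proof seat p39, gen 13), HOME `run/shared/lean/pub/lit-balaban/`, 2026-08-22.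

References: [Balaban1983Higgs3] T. Bałaban, CMP 88 (1983) 411–445, (2.23)–(2.28) pp. 430–431.
-/

noncomputable section

open scoped BigOperators InnerProductSpace

namespace Literature.MathematicalPhysics.QuantumFieldTheory.Balaban1983to89.B3WT228Left

open _root_.MeasureTheory
open LatticeFieldCalculus B3WT223Instance B3WT224Instance B3WT226Pairings B3WT226Derivative

variable {P : Params} {j N : ℕ} (C : HiggsLattice.ChargeData N) (η w c M2 : ℝ)

/-! ## §1 The `A`-derivative of (2.24) at `A = 0` in the presence of a gauge-invariant `F` -/

/-- **"Doing next the same operations as above but in the presence of F(φ)"** (p. 431): for every continuous gauge-invariant `F`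
of exponential-linear growth, every direction `B` of the vector field and every gauge function `λ`,
`∫dφ e^{−½⟨φ,(−Δ^η+M²)φ⟩} F(φ)[(−cηe⟨∂^ηφ,Bqφ⟩)⟨∂^ηφ,∂^ηλqφ⟩ − cηe⟨φ,B·∂^ηλq²φ⟩ − ηe⟨∂^ηφ,B∂^ηλq²φ⟩] = 0`
(`η^d = w > 0`, `M² > 0`, `cηe ≠ 0`).  Proof = the printed route: (2.24) with `F` along `A = sB` (`B3WT224Instance.eq224`, every `s`),
differentiated at `s = 0` under the integral sign, `B3Sect2StatementsPart2.deriv_eq_zero_of_invariant` BY NAME, and the splitting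
`pairDAdot|_{A=0}` of `B3WT226Pairings`. [cite: Balaban1983Higgs3, (2.28) p.431] -/
theorem eq226F_deriv (hw : 0 < w) (hM : 0 < M2) (hce : c * η * C.e ≠ 0) (B : VecField P j ℝ) (lam : Site P j → ℝ)
    (F : Cfg P j N → ℝ) (hFinv : ∀ (lam' : Site P j → ℝ) (φ : Cfg P j N), F (rot C η c lam' φ) = F φ)
    (hFcont : Continuous F) (hFgr : ∃ K κ : ℝ, ∀ φ, |F φ| ≤ K * Real.exp (κ * ‖φ‖)) :
    ∫ φ, weight C η w c M2 (0 : VecField P j ℝ) φ *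
      (F φ * ((-(c * η * C.e) * curJ C w c B φ) * pairD C w c lam φ - (c * η * C.e) * locQ C w c B lam φ
        - (η * C.e) * derQ C w c B lam φ)) = 0 := by
  obtain ⟨K, κ, hK⟩ := hFgr
  have hK0 : 0 ≤ K := by
    have h := hK 0
    have h1 : (0 : ℝ) ≤ K * Real.exp (κ * ‖(0 : Cfg P j N)‖) := (abs_nonneg _).trans h
    simpa using h1
  -- `|F φ| ≤ K e^{|κ|‖φ‖}`
  have hK' : ∀ φ : Cfg P j N, |F φ| ≤ K * Real.exp (|κ| * ‖φ‖) := fun φ =>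
    (hK φ).trans (mul_le_mul_of_nonneg_left (Real.exp_le_exp.mpr
      (mul_le_mul_of_nonneg_right (le_abs_self κ) (norm_nonneg φ))) hK0)
  -- the family `G s = e^{−½⟨φ,(−Δ_{sB}+M²)φ⟩}⟨D_{sB}φ, ∂λqU(sB)φ⟩F(φ)` and its `s`-derivative `G'`
  set G : ℝ → Cfg P j N → ℝ := fun s φ => (weight C η w c M2 (s • B) φ * pairDA C η w c (s • B) lam φ) * F φ with hG
  set G' : ℝ → Cfg P j N → ℝ := fun s φ =>
    (-(c * η * C.e) * (weight C η w c M2 (s • B) φ * pairJ C η w c (s • B) B φ) * pairDA C η w c (s • B) lam φ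
      + weight C η w c M2 (s • B) φ * pairDAdot C η w c (s • B) B lam φ) * F φ with hG'
  -- (2.24) with `F`: the family of integrals vanishes identically
  have hzero_s : ∀ s : ℝ, ∫ φ, G s φ = 0 := fun s => by
    have h := eq224 C η w c M2 hw hM hce (s • B) lam F hFinv hFcont ⟨K, κ, hK⟩
    rw [← h]
    exact integral_congr_ae (Filter.Eventually.of_forall fun φ => by simp only [hG]; ring)
  have hconst : ∀ s : ℝ, ∫ φ, G s φ = ∫ φ, G 0 φ := fun s => by rw [hzero_s s, hzero_s 0]
  -- the Gaussian majorant
  set a : ℝ := M2 * w / 2 with ha_def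
  have ha : 0 < a := by positivity
  have hKB := pairBoundV_nonneg w c B
  have hKL := pairBoundV_nonneg w c (grad c lam)
  have hKD := dotBound_nonneg C η w c B lam
  set M : ℝ := (|c * η * C.e| * pairBoundV w c B * pairBoundV w c (grad c lam) + dotBound C η w c B lam) * K with hM_def
  set bound : Cfg P j N → ℝ := fun φ =>
    M * (Real.exp ((4 + |κ|) * ‖φ‖) * Real.exp (-a * ∑ x : Site P j, ‖φ x‖ ^ 2)) with hbound
  have hbound_int : Integrable bound :=
    (integrable_explin_mul_gauss (P := P) (j := j) (N := N) (4 + |κ|) ha).const_mul M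
  have hsq_exp : ∀ φ : Cfg P j N, ‖φ‖ ^ 2 ≤ Real.exp (2 * ‖φ‖) := fun φ => by
    have h1 : ‖φ‖ ≤ Real.exp ‖φ‖ := by linarith [Real.add_one_le_exp ‖φ‖]
    calc ‖φ‖ ^ 2 ≤ Real.exp ‖φ‖ ^ 2 := pow_le_pow_left₀ (norm_nonneg _) h1 2
      _ = Real.exp (2 * ‖φ‖) := by rw [← Real.exp_nat_mul]; norm_num
  have hsq4 : ∀ φ : Cfg P j N, ‖φ‖ ^ 2 * ‖φ‖ ^ 2 ≤ Real.exp (4 * ‖φ‖) := fun φ => by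
    have h := mul_le_mul (hsq_exp φ) (hsq_exp φ) (sq_nonneg _) (Real.exp_pos _).le
    rwa [← Real.exp_add, show 2 * ‖φ‖ + 2 * ‖φ‖ = 4 * ‖φ‖ by ring] at h
  have hsq2 : ∀ φ : Cfg P j N, ‖φ‖ ^ 2 ≤ Real.exp (4 * ‖φ‖) := fun φ =>
    (hsq_exp φ).trans (Real.exp_le_exp.mpr (by nlinarith [norm_nonneg φ]))
  have hexp4κ : ∀ φ : Cfg P j N, Real.exp (4 * ‖φ‖) * Real.exp (|κ| * ‖φ‖) = Real.exp ((4 + |κ|) * ‖φ‖) := fun φ => by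
    rw [← Real.exp_add]; ring_nf
  have hwt : ∀ (s : ℝ) (φ : Cfg P j N), weight C η w c M2 (s • B) φ ≤ Real.exp (-a * ∑ x : Site P j, ‖φ x‖ ^ 2) :=
    fun s φ => weight_le_gauss hw.le _ φ
  have h_bound : ∀ᵐ φ ∂(volume : Measure (Cfg P j N)), ∀ s ∈ Metric.ball (0 : ℝ) 1, ‖G' s φ‖ ≤ bound φ := by
    refine Filter.Eventually.of_forall fun φ s _ => ?_
    have hWpos := weight_pos (C := C) (η := η) (w := w) (c := c) (M2 := M2) (s • B) φ
    set W := weight C η w c M2 (s • B) φ with hW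
    set E := Real.exp (-a * ∑ x : Site P j, ‖φ x‖ ^ 2) with hE
    have hEnn : 0 ≤ E := (Real.exp_pos _).le
    -- the `F = 1` majorant of `B3WT226Derivative.eq226_deriv`, times `|F φ|`
    have e2 : ‖G' s φ‖ ≤ (|c * η * C.e| * (W * |pairJ C η w c (s • B) B φ|) * |pairDA C η w c (s • B) lam φ|
        + W * |pairDAdot C η w c (s • B) B lam φ|) * |F φ| := by
      simp only [hG', Real.norm_eq_abs]
      rw [abs_mul]
      refine mul_le_mul_of_nonneg_right ((abs_add_le _ _).trans (le_of_eq ?_)) (abs_nonneg _)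
      rw [abs_mul, abs_mul, abs_mul, abs_mul, abs_neg, abs_of_pos hWpos]
    have t1 : |c * η * C.e| * (W * |pairJ C η w c (s • B) B φ|) * |pairDA C η w c (s • B) lam φ|
        ≤ |c * η * C.e| * (E * (pairBoundV w c B * ‖φ‖ ^ 2)) * (pairBoundV w c (grad c lam) * ‖φ‖ ^ 2) := by
      refine mul_le_mul (mul_le_mul_of_nonneg_left ?_ (abs_nonneg _)) ?_ (abs_nonneg _) (by positivity)
      · exact mul_le_mul (hwt s φ) (abs_pairJ_le C η w c (s • B) B φ) (abs_nonneg _) hEnn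
      · rw [pairDA_eq_pairJ]
        exact abs_pairJ_le C η w c (s • B) (grad c lam) φ
    have t2 : W * |pairDAdot C η w c (s • B) B lam φ| ≤ E * (dotBound C η w c B lam * ‖φ‖ ^ 2) :=
      mul_le_mul (hwt s φ) (abs_pairDAdot_le C η w c (s • B) B lam φ) (abs_nonneg _) hEnn
    have t3 : |c * η * C.e| * pairBoundV w c B * pairBoundV w c (grad c lam) * (‖φ‖ ^ 2 * ‖φ‖ ^ 2) * E
        ≤ |c * η * C.e| * pairBoundV w c B * pairBoundV w c (grad c lam) * Real.exp (4 * ‖φ‖) * E :=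
      mul_le_mul_of_nonneg_right (mul_le_mul_of_nonneg_left (hsq4 φ) (by positivity)) hEnn
    have t4 : dotBound C η w c B lam * ‖φ‖ ^ 2 * E ≤ dotBound C η w c B lam * Real.exp (4 * ‖φ‖) * E :=
      mul_le_mul_of_nonneg_right (mul_le_mul_of_nonneg_left (hsq2 φ) hKD) hEnn
    have t5 : |c * η * C.e| * (W * |pairJ C η w c (s • B) B φ|) * |pairDA C η w c (s • B) lam φ|
        + W * |pairDAdot C η w c (s • B) B lam φ| ≤
        (|c * η * C.e| * pairBoundV w c B * pairBoundV w c (grad c lam) + dotBound C η w c B lam) *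
          (Real.exp (4 * ‖φ‖) * E) := by
      calc |c * η * C.e| * (W * |pairJ C η w c (s • B) B φ|) * |pairDA C η w c (s • B) lam φ|
            + W * |pairDAdot C η w c (s • B) B lam φ|
          ≤ |c * η * C.e| * (E * (pairBoundV w c B * ‖φ‖ ^ 2)) * (pairBoundV w c (grad c lam) * ‖φ‖ ^ 2)
            + E * (dotBound C η w c B lam * ‖φ‖ ^ 2) := add_le_add t1 t2
        _ = |c * η * C.e| * pairBoundV w c B * pairBoundV w c (grad c lam) * (‖φ‖ ^ 2 * ‖φ‖ ^ 2) * E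
            + dotBound C η w c B lam * ‖φ‖ ^ 2 * E := by ring
        _ ≤ |c * η * C.e| * pairBoundV w c B * pairBoundV w c (grad c lam) * Real.exp (4 * ‖φ‖) * E
            + dotBound C η w c B lam * Real.exp (4 * ‖φ‖) * E := add_le_add t3 t4
        _ = _ := by ring
    refine e2.trans ((mul_le_mul t5 (hK' φ) (abs_nonneg _) (by positivity)).trans (le_of_eq ?_))
    simp only [hbound, hM_def]
    rw [← hexp4κ φ]
    ring
  have h_diff : ∀ᵐ φ ∂(volume : Measure (Cfg P j N)), ∀ s ∈ Metric.ball (0 : ℝ) 1, HasDerivAt (G · φ) (G' s φ) s := by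
    refine Filter.Eventually.of_forall fun φ s _ => ?_
    simp only [hG, hG']
    exact ((hasDerivAt_weight_lin C η w c M2 B φ s).mul (hasDerivAt_pairDA_lin C η w c B lam φ s)).mul_const (F φ)
  have hG_meas : ∀ s : ℝ, AEStronglyMeasurable (G s) (volume : Measure (Cfg P j N)) := fun s =>
    (((continuous_weight C η w c M2 _).mul (continuous_pairDA C η w c _ lam)).mul hFcont).aestronglyMeasurable
  have hG'_meas : AEStronglyMeasurable (G' 0) (volume : Measure (Cfg P j N)) :=
    ((((continuous_const.mul ((continuous_weight C η w c M2 _).mul (continuous_pairJ C η w c _ B))).mul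
      (continuous_pairDA C η w c _ lam)).add ((continuous_weight C η w c M2 _).mul (continuous_pairDAdot C η w c _ B lam))).mul
      hFcont).aestronglyMeasurable
  have hG_int : Integrable (G 0) (volume : Measure (Cfg P j N)) := by
    refine ((integrable_explin_mul_gauss (P := P) (j := j) (N := N) (2 + |κ|) ha).const_mul
      (pairBoundV w c (grad c lam) * K)).mono' (hG_meas 0) (Filter.Eventually.of_forall fun φ => ?_)
    have hWpos := weight_pos (C := C) (η := η) (w := w) (c := c) (M2 := M2) ((0 : ℝ) • B) φ
    have e3 : ‖G 0 φ‖ = weight C η w c M2 ((0 : ℝ) • B) φ * |pairDA C η w c ((0 : ℝ) • B) lam φ| * |F φ| := by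
      simp only [hG, Real.norm_eq_abs, abs_mul, abs_of_pos hWpos]
    rw [e3]
    have h2 : |pairDA C η w c ((0 : ℝ) • B) lam φ| ≤ pairBoundV w c (grad c lam) * ‖φ‖ ^ 2 := by
      rw [pairDA_eq_pairJ]
      exact abs_pairJ_le C η w c _ (grad c lam) φ
    have hexp2κ : Real.exp (2 * ‖φ‖) * Real.exp (|κ| * ‖φ‖) = Real.exp ((2 + |κ|) * ‖φ‖) := by
      rw [← Real.exp_add]; ring_nf
    calc weight C η w c M2 ((0 : ℝ) • B) φ * |pairDA C η w c ((0 : ℝ) • B) lam φ| * |F φ|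
        ≤ Real.exp (-a * ∑ x : Site P j, ‖φ x‖ ^ 2) * (pairBoundV w c (grad c lam) * Real.exp (2 * ‖φ‖)) *
            (K * Real.exp (|κ| * ‖φ‖)) :=
          mul_le_mul (mul_le_mul (hwt 0 φ) (h2.trans (mul_le_mul_of_nonneg_left (hsq_exp φ) hKL)) (abs_nonneg _)
            (Real.exp_pos _).le) (hK' φ) (abs_nonneg _) (by positivity)
      _ = pairBoundV w c (grad c lam) * K *
            ((Real.exp (2 * ‖φ‖) * Real.exp (|κ| * ‖φ‖)) * Real.exp (-a * ∑ x : Site P j, ‖φ x‖ ^ 2)) := by ring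
      _ = pairBoundV w c (grad c lam) * K *
            (Real.exp ((2 + |κ|) * ‖φ‖) * Real.exp (-a * ∑ x : Site P j, ‖φ x‖ ^ 2)) := by rw [hexp2κ]
  -- differentiation under the integral sign, and `f' = 0` for the constant family
  have hD := (hasDerivAt_integral_of_dominated_loc_of_deriv_le (Metric.ball_mem_nhds (0 : ℝ) one_pos)
    (Filter.Eventually.of_forall hG_meas) hG_int hG'_meas h_bound hbound_int h_diff).2
  have hzero := B3Sect2StatementsPart2.deriv_eq_zero_of_invariant hconst hD
  have hint : ∫ φ, G' 0 φ = ∫ φ, weight C η w c M2 (0 : VecField P j ℝ) φ *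
      (F φ * ((-(c * η * C.e) * curJ C w c B φ) * pairD C w c lam φ - (c * η * C.e) * locQ C w c B lam φ
        - (η * C.e) * derQ C w c B lam φ)) := by
    refine integral_congr_ae (Filter.Eventually.of_forall fun φ => ?_)
    simp only [hG', zero_smul]
    rw [pairJ_zero, pairDA_zero, pairDAdot_zero]
    ring
  rw [hint] at hzero
  exact hzero

/-- **the identity in the presence of `F`, with the normal ordering and the normalization `Z`** (the `F`-analogue of
`B3WT226Derivative.eq226_left`; the normal ordering `:⟨∂^ηφ,∂^ηλqφ⟩:` is harmless since its subtracted mean vanishes by (2.25)):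
`Z⁻¹∫dφ e^{−½⟨φ,(−Δ^η+M²)φ⟩}F(φ)[(−cηe⟨∂^ηφ,Bqφ⟩):⟨∂^ηφ,∂^ηλqφ⟩: − cηe⟨φ,B·∂^ηλq²φ⟩ − ηe⟨∂^ηφ,B∂^ηλq²φ⟩] = 0`.
[cite: Balaban1983Higgs3, (2.28) p.431] -/
theorem eq226F_left (hw : 0 < w) (hM : 0 < M2) (hce : c * η * C.e ≠ 0) (B : VecField P j ℝ) (lam : Site P j → ℝ)
    (F : Cfg P j N → ℝ) (hFinv : ∀ (lam' : Site P j → ℝ) (φ : Cfg P j N), F (rot C η c lam' φ) = F φ)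
    (hFcont : Continuous F) (hFgr : ∃ K κ : ℝ, ∀ φ, |F φ| ≤ K * Real.exp (κ * ‖φ‖)) :
    (∫ φ, weight C η w c M2 (0 : VecField P j ℝ) φ *
      (F φ * ((-(c * η * C.e) * curJ C w c B φ) * normOrd C η w c M2 (pairD C w c lam) φ
        - (c * η * C.e) * locQ C w c B lam φ - (η * C.e) * derQ C w c B lam φ))) /
      ∫ φ, weight C η w c M2 (0 : VecField P j ℝ) φ = 0 := by
  rw [normOrd_pairD C η w c M2 hw hM hce lam, eq226F_deriv C η w c M2 hw hM hce B lam F hFinv hFcont hFgr, zero_div]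

/-- `F = 1` recovers (2.26)'s left member (`B3WT226Derivative.eq226_left`). [cite: Balaban1983Higgs3, (2.26) p.431] -/
theorem eq226F_left_one (hw : 0 < w) (hM : 0 < M2) (hce : c * η * C.e ≠ 0) (B : VecField P j ℝ) (lam : Site P j → ℝ) :
    (∫ φ, weight C η w c M2 (0 : VecField P j ℝ) φ *
      ((1 : ℝ) * ((-(c * η * C.e) * curJ C w c B φ) * normOrd C η w c M2 (pairD C w c lam) φ
        - (c * η * C.e) * locQ C w c B lam φ - (η * C.e) * derQ C w c B lam φ))) /
      ∫ φ, weight C η w c M2 (0 : VecField P j ℝ) φ = 0 :=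
  eq226F_left C η w c M2 hw hM hce B lam (fun _ => 1) (fun _ _ => rfl) continuous_const ⟨1, 0, fun _ => by simp⟩

/-! ## §2 The admissible functions of p. 430: Wick-ordered local even polynomials `Σ_xη^d(α|φ(x)|⁴ + β|φ(x)|² + γ)` -/

/-- gauge invariance of the local even polynomials `Σ_xη^d(α(x)|φ(x)|⁴ + β(x)|φ(x)|² + γ(x))` — the functions
`−λ_kΣη^d:|φ(x)|⁴:`, `−½Σδm²_l(x)η^d:|φ(x)|²:`, `−λ_kC^η_{M²}(0)Ση^d:|φ(x)|²:` of p. 430 are of this form (the sitewise rotations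
`U(λ(x))` are unitary). [cite: Balaban1983Higgs3, (2.24) p.430 (the admissible F)] -/
theorem localEvenPoly_rot (α β γ : Site P j → ℝ) (lam : Site P j → ℝ) (φ : Cfg P j N) :
    (∑ x : Site P j, w * (α x * ‖rot C η c lam φ x‖ ^ 4 + β x * ‖rot C η c lam φ x‖ ^ 2 + γ x)) =
      ∑ x : Site P j, w * (α x * ‖φ x‖ ^ 4 + β x * ‖φ x‖ ^ 2 + γ x) := by
  refine Finset.sum_congr rfl fun x _ => ?_
  rw [rot_apply, ContinuousLinearMap.norm_map_of_mem_unitary (C.U_mem_unitary η _)]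

omit C η in
/-- continuity of the local even polynomials. [cite: Balaban1983Higgs3, (2.24) p.430 (the admissible F)] -/
theorem continuous_localEvenPoly (α β γ : Site P j → ℝ) :
    Continuous fun φ : Cfg P j N => ∑ x : Site P j, w * (α x * ‖φ x‖ ^ 4 + β x * ‖φ x‖ ^ 2 + γ x) :=
  continuous_finsetSum _ fun x _ => continuous_const.mul
    (((continuous_const.mul ((continuous_apply x).norm.pow 4)).add
      (continuous_const.mul ((continuous_apply x).norm.pow 2))).add continuous_const)

omit C η in
/-- exponential-linear growth of the local even polynomials: `|Σ_xη^d(α|φ(x)|⁴ + β|φ(x)|² + γ)| ≤ Ke^{4‖φ‖}` with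
`K = Σ_x|η^d|(|α(x)| + |β(x)| + |γ(x)|)`. [cite: Balaban1983Higgs3, (2.24) p.430 (the admissible F)] -/
theorem abs_localEvenPoly_le (α β γ : Site P j → ℝ) (φ : Cfg P j N) :
    |∑ x : Site P j, w * (α x * ‖φ x‖ ^ 4 + β x * ‖φ x‖ ^ 2 + γ x)| ≤
      (∑ x : Site P j, |w| * (|α x| + |β x| + |γ x|)) * Real.exp (4 * ‖φ‖) := by
  have hsq_exp : ‖φ‖ ^ 2 ≤ Real.exp (2 * ‖φ‖) := by
    have h1 : ‖φ‖ ≤ Real.exp ‖φ‖ := by linarith [Real.add_one_le_exp ‖φ‖]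
    calc ‖φ‖ ^ 2 ≤ Real.exp ‖φ‖ ^ 2 := pow_le_pow_left₀ (norm_nonneg _) h1 2
      _ = Real.exp (2 * ‖φ‖) := by rw [← Real.exp_nat_mul]; norm_num
  have h4 : ‖φ‖ ^ 4 ≤ Real.exp (4 * ‖φ‖) := by
    have h := mul_le_mul hsq_exp hsq_exp (sq_nonneg _) (Real.exp_pos _).le
    rw [← Real.exp_add, show 2 * ‖φ‖ + 2 * ‖φ‖ = 4 * ‖φ‖ by ring] at h
    calc ‖φ‖ ^ 4 = ‖φ‖ ^ 2 * ‖φ‖ ^ 2 := by ring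
      _ ≤ _ := h
  have h2 : ‖φ‖ ^ 2 ≤ Real.exp (4 * ‖φ‖) :=
    hsq_exp.trans (Real.exp_le_exp.mpr (by nlinarith [norm_nonneg φ]))
  have h0 : (1 : ℝ) ≤ Real.exp (4 * ‖φ‖) := Real.one_le_exp (by positivity)
  have hx : ∀ x : Site P j, ‖φ x‖ ≤ ‖φ‖ := fun x => norm_le_pi_norm φ x
  refine (Finset.abs_sum_le_sum_abs _ _).trans ?_
  rw [Finset.sum_mul]
  refine Finset.sum_le_sum fun x _ => ?_
  rw [abs_mul]
  have hx4 : ‖φ x‖ ^ 4 ≤ Real.exp (4 * ‖φ‖) := (pow_le_pow_left₀ (norm_nonneg _) (hx x) 4).trans h4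
  have hx2 : ‖φ x‖ ^ 2 ≤ Real.exp (4 * ‖φ‖) := (pow_le_pow_left₀ (norm_nonneg _) (hx x) 2).trans h2
  have hin : |α x * ‖φ x‖ ^ 4 + β x * ‖φ x‖ ^ 2 + γ x| ≤ (|α x| + |β x| + |γ x|) * Real.exp (4 * ‖φ‖) := by
    refine (abs_add_le _ _).trans ((add_le_add (abs_add_le _ _) le_rfl).trans ?_)
    rw [abs_mul, abs_mul, abs_of_nonneg (by positivity : (0 : ℝ) ≤ ‖φ x‖ ^ 4),
      abs_of_nonneg (by positivity : (0 : ℝ) ≤ ‖φ x‖ ^ 2)]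
    have e1 := mul_le_mul_of_nonneg_left hx4 (abs_nonneg (α x))
    have e2 := mul_le_mul_of_nonneg_left hx2 (abs_nonneg (β x))
    have e3 : |γ x| ≤ |γ x| * Real.exp (4 * ‖φ‖) := le_mul_of_one_le_right (abs_nonneg _) h0
    linarith
  calc |w| * |α x * ‖φ x‖ ^ 4 + β x * ‖φ x‖ ^ 2 + γ x|
      ≤ |w| * ((|α x| + |β x| + |γ x|) * Real.exp (4 * ‖φ‖)) := mul_le_mul_of_nonneg_left hin (abs_nonneg _)
    _ = |w| * (|α x| + |β x| + |γ x|) * Real.exp (4 * ‖φ‖) := by ring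

/-- **(2.28), LEFT MEMBER, on the concrete lattice model**: the identity obtained from (2.24) by *"the same operations as above
but in the presence of F(φ) = −λ_kΣ_{x∈Δ}η^d:|φ(x)|⁴:"* — and for every local even polynomial
`F(φ) = Σ_xη^d(α(x)|φ(x)|⁴ + β(x)|φ(x)|² + γ(x))` (all three admissible `F` of p. 430, any Wick-ordering constants) — VANISHES:
`Z⁻¹∫dφ e^{−½⟨φ,(−Δ^η+M²)φ⟩}F(φ)[(−cηe⟨∂^ηφ,Bqφ⟩):⟨∂^ηφ,∂^ηλqφ⟩: − cηe⟨φ,B·∂^ηλq²φ⟩ − ηe⟨∂^ηφ,B∂^ηλq²φ⟩] = 0` for every direction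
`B` and gauge function `λ` (`η^d = w > 0`, `M² > 0`, `cηe ≠ 0`).  The RIGHT member (the pictures (2.28): these Gaussian integrals
evaluated by Wick's theorem) is not drawn here. [cite: Balaban1983Higgs3, (2.28) p.431] -/
theorem eq228_left (hw : 0 < w) (hM : 0 < M2) (hce : c * η * C.e ≠ 0) (B : VecField P j ℝ) (lam : Site P j → ℝ)
    (α β γ : Site P j → ℝ) :
    (∫ φ, weight C η w c M2 (0 : VecField P j ℝ) φ *
      ((∑ x : Site P j, w * (α x * ‖φ x‖ ^ 4 + β x * ‖φ x‖ ^ 2 + γ x)) *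
        ((-(c * η * C.e) * curJ C w c B φ) * normOrd C η w c M2 (pairD C w c lam) φ
          - (c * η * C.e) * locQ C w c B lam φ - (η * C.e) * derQ C w c B lam φ))) /
      ∫ φ, weight C η w c M2 (0 : VecField P j ℝ) φ = 0 :=
  eq226F_left C η w c M2 hw hM hce B lam _ (fun lam' φ => localEvenPoly_rot C η w c α β γ lam' φ)
    (continuous_localEvenPoly w α β γ) ⟨_, 4, fun φ => abs_localEvenPoly_le w α β γ φ⟩

/-- (2.28), left member, without the normalization and the (harmless) normal ordering.
[cite: Balaban1983Higgs3, (2.28) p.431] -/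
theorem eq228_deriv (hw : 0 < w) (hM : 0 < M2) (hce : c * η * C.e ≠ 0) (B : VecField P j ℝ) (lam : Site P j → ℝ)
    (α β γ : Site P j → ℝ) :
    ∫ φ, weight C η w c M2 (0 : VecField P j ℝ) φ *
      ((∑ x : Site P j, w * (α x * ‖φ x‖ ^ 4 + β x * ‖φ x‖ ^ 2 + γ x)) *
        ((-(c * η * C.e) * curJ C w c B φ) * pairD C w c lam φ - (c * η * C.e) * locQ C w c B lam φ
          - (η * C.e) * derQ C w c B lam φ)) = 0 :=
  eq226F_deriv C η w c M2 hw hM hce B lam _ (fun lam' φ => localEvenPoly_rot C η w c α β γ lam' φ)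
    (continuous_localEvenPoly w α β γ) ⟨_, 4, fun φ => abs_localEvenPoly_le w α β γ φ⟩

end Literature.MathematicalPhysics.QuantumFieldTheory.Balaban1983to89.B3WT228Left

end
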